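import Mathlib.LinearAlgebra.Matrix.Permanent
import Mathlib.Data.Fin.SuccPred
import Mathlib.Algebra.BigOperators.Fin
import Literature.LinearAlgebra.Matrix.PermanentLaplace
import HarnessLib

/-!
# The permanent of a matrix with two equal rows

Row-additivity of Mathlib's `Matrix.permanent` and the identity behind L. G. Valiant's
polynomial-time algorithm for the permanent modulo `2^k` (*The complexity of computing the
permanent*, TCS 8 (1979), Thm. 3 and its proof: "the permanent of any matrix with two equal rows
is even", because the ordered double Laplace expansion along the two equal rows counts every
minor twice). Precisely, if rows `a` and `a.succAbove p` of an `(n+2) × (n+2)` matrix `B` over a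
commutative semiring agree, then

`per B = 2 · ∑_{b < b''} B a b · B a b'' · per (B with rows a, a.succAbove p and columns b, b'' deleted)`,

where the column pair is encoded as `(b, b')` with `b'' = b.succAbove b'` and `b ≤ b'` (as
naturals), and the minor is `B.submatrix (a.succAbove ∘ p.succAbove) (b.succAbove ∘ b'.succAbove)`.
Adding `d ·` (row `j`) to row `i` therefore changes the permanent by `d · per (B with row i
replaced by row j)`, a matrix with two equal rows — so modulo `2^k` the correction only needs
`n × n` minors modulo `2^(k-1)` (Valiant's recursion).

* `permanent_updateRow_add`, `permanent_updateRow_add_smul` — the permanent is additive in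
  each row (Mathlib has the homogeneity `Matrix.permanent_updateRow_smul` only), and the effect
  of the row operation `row i ↦ row i + c · row j`;
* `updateRow_succAbove_row_eq` — after `row a ↦ row (a.succAbove p)` the two rows agree;
* `permanent_eq_sum_sum_of_row_eq` — the ORDERED double Laplace expansion along the two equal
  rows;
* `sum_sum_eq_two_mul_sum_sum_ite` — folding a swap-invariant sum over ordered pairs of
  distinct indices `(b, b.succAbove b')` onto the pairs with `b ≤ b'`, through the involution
  `(b, b') ↦ (b.succAbove b', b'.predAbove b)` (`Fin.succAbove_succAbove_predAbove`);
* `permanent_eq_two_mul_sum_of_row_eq` — the displayed identity.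

Everything holds over a commutative semiring (no signs, no subtraction, no division by `2`).

## References

* L. G. Valiant, *The complexity of computing the permanent*, Theoret. Comput. Sci. 8 (1979)
  189–201, Thm. 3 and its proof (p. 199: computing `per A mod 2^k` in `O(n^{4k-3})` steps; "the
  permanent of any matrix with two equal rows is even").
* H. Minc, *Permanents*, Encyclopedia of Mathematics and its Applications 6, Addison-Wesley
  1978, §1.1–§1.2 (multilinearity in the rows, Laplace expansion). (Not held; elementary and
  fully proved here.)
-/

namespace Literature.LinearAlgebra.Matrix

open Equiv Finset _root_.Matrix

variable {R : Type*} [CommSemiring R]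

/-! ### Row-additivity -/

section Additive

variable {m : Type*} [Fintype m] [DecidableEq m]

/-- **The permanent is additive in each row**: `per (A with row i ↦ u + v) =
per (A with row i ↦ u) + per (A with row i ↦ v)` (split each product at its factor from row
`i`; by transposition from the column version). Companion of Mathlib's
`Matrix.permanent_updateRow_smul`. [folklore] -/
theorem permanent_updateRow_add (A : Matrix m m R) (i : m) (u v : m → R) :
    (A.updateRow i (u + v)).permanent =
      (A.updateRow i u).permanent + (A.updateRow i v).permanent := by
  have key : ∀ w : m → R, (A.updateRow i w).permanent = (Aᵀ.updateCol i w).permanent :=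
    fun w => by rw [updateCol_transpose, permanent_transpose]
  rw [key, key, key]
  unfold Matrix.permanent
  rw [← Finset.sum_add_distrib]
  refine Finset.sum_congr rfl fun σ _ => ?_
  have h : ∀ w : m → R,
      ∏ j, (Aᵀ.updateCol i w) (σ j) j = w (σ i) * ∏ j ∈ univ.erase i, Aᵀ (σ j) j := by
    intro w
    rw [← Finset.mul_prod_erase _ _ (Finset.mem_univ i), updateCol_self]
    congr 1
    exact Finset.prod_congr rfl fun j hj => by rw [updateCol_ne (Finset.ne_of_mem_erase hj)]
  rw [h, h, h, Pi.add_apply, add_mul]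

/-- **Row operations and the permanent**: replacing row `i` of `A` by `row i + c · row j`
changes the permanent by `c · per (A with row i replaced by row j)` (row-additivity and
homogeneity; for `j ≠ i` the last matrix has two equal rows). This is the step "adding any
multiple of one row to another" of Valiant's `mod 2^k` algorithm. [cite: Valiant1979, Thm. 3 (proof)] -/
theorem permanent_updateRow_add_smul (A : Matrix m m R) (i j : m) (c : R) :
    (A.updateRow i (A i + c • A j)).permanent =
      A.permanent + c * (A.updateRow i (A j)).permanent := by
  rw [permanent_updateRow_add, updateRow_eq_self, permanent_updateRow_smul]

/-- After replacing row `a` by row `a.succAbove p`, rows `a` and `a.succAbove p` agree (the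
hypothesis shape of `permanent_eq_two_mul_sum_of_row_eq`). [folklore] -/
theorem updateRow_succAbove_row_eq {k : ℕ} {m' α : Type*} (A : Matrix (Fin (k + 1)) m' α)
    (a : Fin (k + 1)) (p : Fin k) :
    A.updateRow a (A (a.succAbove p)) a = A.updateRow a (A (a.succAbove p)) (a.succAbove p) := by
  rw [updateRow_self, updateRow_ne (Fin.succAbove_ne a p)]

end Additive

/-! ### Double Laplace expansion along two equal rows -/

/-- **Ordered double Laplace expansion along two equal rows.** If rows `a` and `a.succAbove p`
of `B` agree, then `per B = ∑_b ∑_{b'} B a b · B a (b.succAbove b') · per (minor)`, the minor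
deleting rows `a, a.succAbove p` and columns `b, b.succAbove b'` (expand along row `a`, then
along the row of each minor that carries the second copy of row `a`). [cite: Valiant1979, Thm. 3 (proof)] -/
theorem permanent_eq_sum_sum_of_row_eq {n : ℕ} (B : Matrix (Fin (n + 2)) (Fin (n + 2)) R)
    (a : Fin (n + 2)) (p : Fin (n + 1)) (h : B a = B (a.succAbove p)) :
    B.permanent = ∑ b : Fin (n + 2), ∑ b' : Fin (n + 1),
      B a b * B a (b.succAbove b') *
        (B.submatrix (a.succAbove ∘ p.succAbove) (b.succAbove ∘ b'.succAbove)).permanent := by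
  rw [Matrix.permanent_eq_sum_row B a]
  refine Finset.sum_congr rfl fun b _ => ?_
  rw [Matrix.permanent_eq_sum_row _ p, Finset.mul_sum]
  refine Finset.sum_congr rfl fun b' _ => ?_
  rw [submatrix_apply, submatrix_submatrix, ← h, mul_assoc]

/-- **Folding ordered pairs onto unordered pairs.** A pair `(b, b') : Fin (n+2) × Fin (n+1)`
encodes the ordered pair of distinct indices `(b, b.succAbove b')`, and `b < b.succAbove b'`
iff `b ≤ b'` as naturals; the involution `(b, b') ↦ (b.succAbove b', b'.predAbove b)` swaps the
two indices (`Fin.succAbove_succAbove_predAbove`, `Fin.predAbove_predAbove_succAbove`). Hence a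
swap-invariant `F` has `∑_{b, b'} F b b' = 2 · ∑_{b ≤ b'} F b b'`. [folklore] -/
theorem sum_sum_eq_two_mul_sum_sum_ite {N : Type*} [NonAssocSemiring N] {n : ℕ}
    (F : Fin (n + 2) → Fin (n + 1) → N)
    (hF : ∀ (b : Fin (n + 2)) (b' : Fin (n + 1)), F (b.succAbove b') (b'.predAbove b) = F b b') :
    ∑ b : Fin (n + 2), ∑ b' : Fin (n + 1), F b b' =
      2 * ∑ b : Fin (n + 2), ∑ b' : Fin (n + 1), if (b : ℕ) ≤ (b' : ℕ) then F b b' else 0 := by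
  -- the involution exchanging the two encoded indices
  let τ : Fin (n + 2) × Fin (n + 1) → Fin (n + 2) × Fin (n + 1) := fun q =>
    (q.1.succAbove q.2, q.2.predAbove q.1)
  have hτ : Function.Involutive τ := fun q =>
    Prod.ext (Fin.succAbove_succAbove_predAbove q.1 q.2) (Fin.predAbove_predAbove_succAbove q.1 q.2)
  -- it exchanges the two halves `b ≤ b'` and `b' < b`
  have hPτ : ∀ q : Fin (n + 2) × Fin (n + 1),
      (((τ q).1 : ℕ) ≤ ((τ q).2 : ℕ)) ↔ ¬ ((q.1 : ℕ) ≤ (q.2 : ℕ)) := by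
    intro q
    simp only [τ, Fin.succAbove, Fin.predAbove, Fin.lt_def, Fin.val_castSucc, apply_dite Fin.val,
      Fin.val_pred, Fin.coe_castPred, dite_eq_ite, apply_ite Fin.val, Fin.val_succ]
    split_ifs <;> omega
  have hFτ : ∀ q : Fin (n + 2) × Fin (n + 1), F (τ q).1 (τ q).2 = F q.1 q.2 := fun q => hF q.1 q.2
  rw [← Fintype.sum_prod_type', ← Fintype.sum_prod_type', two_mul]
  calc ∑ q : Fin (n + 2) × Fin (n + 1), F q.1 q.2
      = ∑ q : Fin (n + 2) × Fin (n + 1),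
          ((if (q.1 : ℕ) ≤ (q.2 : ℕ) then F q.1 q.2 else 0) +
            (if (q.1 : ℕ) ≤ (q.2 : ℕ) then 0 else F q.1 q.2)) :=
        Finset.sum_congr rfl fun q _ => by split_ifs <;> simp
    _ = (∑ q : Fin (n + 2) × Fin (n + 1), if (q.1 : ℕ) ≤ (q.2 : ℕ) then F q.1 q.2 else 0) +
          ∑ q : Fin (n + 2) × Fin (n + 1), if (q.1 : ℕ) ≤ (q.2 : ℕ) then 0 else F q.1 q.2 :=
        Finset.sum_add_distrib
    _ = (∑ q : Fin (n + 2) × Fin (n + 1), if (q.1 : ℕ) ≤ (q.2 : ℕ) then F q.1 q.2 else 0) +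
          ∑ q : Fin (n + 2) × Fin (n + 1),
            if ((τ q).1 : ℕ) ≤ ((τ q).2 : ℕ) then 0 else F (τ q).1 (τ q).2 := by
        congr 1
        exact (Fintype.sum_equiv hτ.toPerm _ _ fun q => rfl).symm
    _ = (∑ q : Fin (n + 2) × Fin (n + 1), if (q.1 : ℕ) ≤ (q.2 : ℕ) then F q.1 q.2 else 0) +
          ∑ q : Fin (n + 2) × Fin (n + 1), if (q.1 : ℕ) ≤ (q.2 : ℕ) then F q.1 q.2 else 0 := by
        congr 1
        refine Finset.sum_congr rfl fun q _ => ?_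
        rw [if_congr (hPτ q) rfl rfl, ite_not, hFτ]

/-- **The permanent of a matrix with two equal rows** (the engine of Valiant's `per mod 2^k`
algorithm, Valiant 1979, proof of Thm. 3: "the permanent of any matrix with two equal rows is
even"). If rows `a` and `a.succAbove p` of an `(n+2) × (n+2)` matrix `B` over a commutative
semiring agree, then `per B` is TWICE the sum, over the column pairs `b < b''`
(`b'' = b.succAbove b'` with `b ≤ b'` as naturals), of `B a b · B a b'' · per (minor)`, the
minor deleting the two equal rows and the two columns: the ordered double Laplace expansion
`permanent_eq_sum_sum_of_row_eq` counts each unordered column pair twice with the same minor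
(`Fin.succAbove_succAbove_succAbove_predAbove`). [cite: Valiant1979, Thm. 3 (proof)] -/
theorem permanent_eq_two_mul_sum_of_row_eq {n : ℕ} (B : Matrix (Fin (n + 2)) (Fin (n + 2)) R)
    (a : Fin (n + 2)) (p : Fin (n + 1)) (h : B a = B (a.succAbove p)) :
    B.permanent = 2 * ∑ b : Fin (n + 2), ∑ b' : Fin (n + 1),
      if (b : ℕ) ≤ (b' : ℕ) then
        B a b * B a (b.succAbove b') *
          (B.submatrix (a.succAbove ∘ p.succAbove) (b.succAbove ∘ b'.succAbove)).permanent
      else 0 := by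
  rw [permanent_eq_sum_sum_of_row_eq B a p h]
  refine sum_sum_eq_two_mul_sum_sum_ite _ fun b b' => ?_
  have hcol : ((b.succAbove b').succAbove ∘ (b'.predAbove b).succAbove : Fin n → Fin (n + 2)) =
      b.succAbove ∘ b'.succAbove :=
    funext fun k => Fin.succAbove_succAbove_succAbove_predAbove b b' k
  rw [hcol, Fin.succAbove_succAbove_predAbove, mul_comm (B a (b.succAbove b')) (B a b)]

end Literature.LinearAlgebra.Matrix
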